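import Mathlib
import Summits.ResolutionOfSingularities.ResolutionOfSingularities.Theorems.WildQuotientsWildQuotientResolutionJordanFourTwistedChart
import Summits.ResolutionOfSingularities.ResolutionOfSingularities.Theorems.WildQuotientsWildQuotientResolutionToricExitWeightZero

/-!
# V4U piece T — parity: the even subalgebra `E` of the twisted root chart (odd variables `s, A, ξ`)

(crux stmt-ResolutionOfSingularities-15640 `WildQuotients.WildQuotientResolution`, line `Sketch`,
sector `|G| = p`; programme V4U of `L/w45c/CHAIN.md` v6 §4 row stub-1 (T1: «the even ∩ fixed form
(parity, odd set {a,b,c})») and `L/w45c/V4U-DESIGN.md` §3 («Γ(W_T) ≅ E_Q, E = adjoin k {s², sA, sξ,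
A², Aξ, ξ²} ∪ {η} ∪ passengers = ι-even part of k[s,A,ξ,η,pass]»). [OURS · L1 W4.5c] — NOT a statement
of any manuscript; replaces the role of no printed item. Prover res-L1-w45c-stub-1.)

Slots `s = X b`, `A = X a`, `ξ = X c`, `η = X d`. The deck involution `ι` negates `X a, X b, X c`.
* `evenGens k n a b c` — the generators of record of `E`:
  `{X a², X a X b, X a X c, X b², X b X c, X c²} ∪ {X i : i ∉ {a,b,c}}`.
* `mem_adjoin_evenGens_iff` — `E` is the degree-`0` part of the parity grading `w`
  (`w a = w b = w c = 1`, `w i = 0` otherwise; values in `ZMod 2`).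
* GENERIC (any parity weight `w : σ → ZMod 2`, any commutative ring `R`): the sign involution
  `X i ↦ −X i` (`w i ≠ 0`), `X i ↦ X i` (`w i = 0`) multiplies `monomial d r` by `(−1)^{weight}`
  (`signAeval_monomial`, `coeff_signAeval`); if `2` is a non-zero-divisor of `R`, its fixed points are
  exactly the `w`-degree-`0` elements (`isWeightedHomogeneous_zero_of_signAeval_eq`).
* Hence (char `k ≠ 2`), by T-ii (`deck_twistedChart`): **`twistedChart_mem_adjoin_evenGens`** — the
  twisted chart lands in `E`; `twistedCofactor_mem_adjoin_evenGens` (the `q`-vector is even);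
  `twistedQ_mem_adjoin_evenGens`.
-/

-- single-problem summit: the doubled namespace component `ResolutionOfSingularities` is forced
set_option linter.dupNamespace false

noncomputable section

open MvPolynomial

namespace Summit.ResolutionOfSingularities.ResolutionOfSingularities.Theorems.WildQuotientResolution.JordanFour

/-- The generators of record of the EVEN subalgebra `E ⊂ k[s, A, ξ, η, passengers]` of the twisted
root chart (odd variables `A = X a`, `s = X b`, `ξ = X c`):
`{X a², X a X b, X a X c, X b², X b X c, X c²} ∪ {X i : i ∉ {a, b, c}}`. [OURS · L1 W4.5c] -/
def evenGens (k : Type) [Field k] (n : ℕ) (a b c : Fin n) : Set (MvPolynomial (Fin n) k) :=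
  ({X a ^ 2, X a * X b, X a * X c, X b ^ 2, X b * X c, X c ^ 2} : Set (MvPolynomial (Fin n) k)) ∪
    ((fun i => X i) '' {i | i ≠ a ∧ i ≠ b ∧ i ≠ c})

section SignInvolution

/-! ### Generic: the sign involution of a parity weight -/

variable {σ R : Type*} [CommRing R] (w : σ → ZMod 2)

/-- **The sign involution on monomials**: `X i ↦ −X i` for `w i ≠ 0` and `X i ↦ X i` for `w i = 0`
multiplies `monomial d r` by `(−1)^{(weight w d).val}`. [folklore] -/
theorem signAeval_monomial (d : σ →₀ ℕ) (r : R) :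
    aeval (fun i => if w i = 0 then (X i : MvPolynomial σ R) else -X i) (monomial d r) =
      (-1) ^ (Finsupp.weight w d).val * monomial d r := by
  classical
  rw [aeval_monomial, MvPolynomial.algebraMap_eq]
  have hsplit : (d.prod fun i k => (if w i = 0 then (X i : MvPolynomial σ R) else -X i) ^ k) =
      (d.prod fun i k => ((-1 : MvPolynomial σ R) ^ (if w i = 0 then 0 else k))) *
        d.prod fun i k => (X i : MvPolynomial σ R) ^ k := by
    rw [← Finsupp.prod_mul]
    refine Finsupp.prod_congr fun i _ => ?_
    split_ifs with h
    · rw [pow_zero, one_mul]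
    · rw [neg_pow, mul_comm]
  rw [hsplit, Finsupp.prod, Finset.prod_pow_eq_pow_sum, ← mul_assoc, mul_comm (C r), mul_assoc,
    ← monomial_eq]
  congr 1
  -- `(−1)^N = (−1)^(weight).val`, `N = Σ_{i ∈ supp d, w i ≠ 0} d i`
  rw [neg_one_pow_eq_pow_mod_two]
  congr 1
  have hw : Finsupp.weight w d =
      ((∑ i ∈ d.support, (if w i = 0 then 0 else d i) : ℕ) : ZMod 2) := by
    rw [Finsupp.weight_apply, Finsupp.sum, Nat.cast_sum]
    refine Finset.sum_congr rfl fun i _ => ?_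
    by_cases h : w i = 0
    · rw [h, if_pos rfl, smul_zero, Nat.cast_zero]
    · have h01 : ∀ x : ZMod 2, x ≠ 0 → x = 1 := by decide
      rw [if_neg h, h01 _ h, Nat.smul_one_eq_cast]
  rw [hw, ZMod.val_natCast]

/-- **Coefficients under the sign involution**: `coeff d (ι f) = (−1)^{(weight w d).val} · coeff d f`.
[folklore] -/
theorem coeff_signAeval (f : MvPolynomial σ R) (d : σ →₀ ℕ) :
    coeff d (aeval (fun i => if w i = 0 then (X i : MvPolynomial σ R) else -X i) f) =
      (-1) ^ (Finsupp.weight w d).val * coeff d f := by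
  classical
  conv_lhs => rw [f.as_sum, map_sum]
  simp_rw [signAeval_monomial]
  rw [coeff_sum]
  simp_rw [show ∀ e : σ →₀ ℕ, ((-1 : MvPolynomial σ R) ^ (Finsupp.weight w e).val * monomial e (coeff e f))
      = monomial e ((-1) ^ (Finsupp.weight w e).val * coeff e f) from fun e => by
    rw [C_mul_monomial.symm, map_pow, map_neg, map_one], coeff_monomial]
  rw [Finset.sum_ite_eq']
  split_ifs with h
  · rfl
  · rw [notMem_support_iff.mp h, mul_zero]

/-- **Fixed points of the sign involution are even** (when `2` is a non-zero-divisor of `R`): if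
`ι f = f` then `f` is `w`-homogeneous of degree `0`. [folklore] -/
theorem isWeightedHomogeneous_zero_of_signAeval_eq (h2 : (2 : R) ∈ nonZeroDivisors R)
    (f : MvPolynomial σ R)
    (hf : aeval (fun i => if w i = 0 then (X i : MvPolynomial σ R) else -X i) f = f) :
    IsWeightedHomogeneous w f 0 := by
  intro d hd
  by_contra hne
  have h01 : ∀ x : ZMod 2, x ≠ 0 → x = 1 := by decide
  have h1 : (Finsupp.weight w d).val = 1 := by
    rw [h01 _ hne]; rfl
  have hc := congrArg (coeff d) hf
  rw [coeff_signAeval, h1, pow_one, neg_one_mul] at hc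
  -- `−c = c` ⇒ `2c = 0` ⇒ `c = 0`
  have h2c : (2 : R) * coeff d f = 0 := by linear_combination (-1 : R) * hc
  exact hd ((mem_nonZeroDivisors_iff_left.mp h2) _ h2c)

end SignInvolution

section EvenSubalgebra

/-! ### The even subalgebra of the twisted chart is the degree-`0` part of the parity grading -/

variable (k : Type) [Field k] (n : ℕ) (a b c : Fin n) (hab : a ≠ b) (hac : a ≠ c) (hbc : b ≠ c)
  (w : Fin n → ZMod 2) (hwa : w a = 1) (hwb : w b = 1) (hwc : w c = 1)
  (hw0 : ∀ i, i ≠ a → i ≠ b → i ≠ c → w i = 0)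

include hwa hwb hwc hw0 in
/-- The generators of `E` are even. [folklore] -/
theorem isWeightedHomogeneous_zero_of_mem_evenGens (g : MvPolynomial (Fin n) k)
    (hg : g ∈ evenGens k n a b c) : IsWeightedHomogeneous w g 0 := by
  have e11 : (1 : ZMod 2) + 1 = 0 := by decide
  have hX : ∀ i, w i = 1 → IsWeightedHomogeneous w (X i : MvPolynomial (Fin n) k) 1 := by
    intro i hi
    have h := isWeightedHomogeneous_X k w i
    rwa [hi] at h
  have hXX : ∀ i j, w i = 1 → w j = 1 →
      IsWeightedHomogeneous w (X i * X j : MvPolynomial (Fin n) k) 0 := by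
    intro i j hi hj
    have h := (hX i hi).mul (hX j hj)
    rwa [e11] at h
  have hsq : ∀ i, w i = 1 → IsWeightedHomogeneous w (X i ^ 2 : MvPolynomial (Fin n) k) 0 := by
    intro i hi
    rw [sq]
    exact hXX i i hi hi
  rcases hg with hg | ⟨i, ⟨hia, hib, hic⟩, rfl⟩
  · simp only [Set.mem_insert_iff, Set.mem_singleton_iff] at hg
    rcases hg with rfl | rfl | rfl | rfl | rfl | rfl
    · exact hsq a hwa
    · exact hXX a b hwa hwb
    · exact hXX a c hwa hwc
    · exact hsq b hwb
    · exact hXX b c hwb hwc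
    · exact hsq c hwc
  · have h := isWeightedHomogeneous_X k w i
    rwa [hw0 i hia hib hic] at h

include hab hac hbc hwa hwb hwc hw0 in
/-- The weight of an exponent vector is the parity of `d a + d b + d c`. [folklore] -/
theorem weight_eq_three (d : Fin n →₀ ℕ) :
    Finsupp.weight w d = ((d a + d b + d c : ℕ) : ZMod 2) := by
  classical
  rw [Finsupp.weight_apply, Finsupp.sum_fintype _ _ (fun i => by simp)]
  have hb' : b ∈ Finset.univ.erase a := Finset.mem_erase.mpr ⟨fun h => hab h.symm, Finset.mem_univ b⟩
  have hc' : c ∈ (Finset.univ.erase a).erase b :=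
    Finset.mem_erase.mpr ⟨fun h => hbc h.symm, Finset.mem_erase.mpr ⟨fun h => hac h.symm,
      Finset.mem_univ c⟩⟩
  rw [← Finset.add_sum_erase _ _ (Finset.mem_univ a), ← Finset.add_sum_erase _ _ hb',
    ← Finset.add_sum_erase _ _ hc', Finset.sum_eq_zero]
  · rw [hwa, hwb, hwc, Nat.smul_one_eq_cast, Nat.smul_one_eq_cast, Nat.smul_one_eq_cast]
    push_cast
    ring
  · intro i hi
    obtain ⟨hic, hi'⟩ := Finset.mem_erase.mp hi
    obtain ⟨hib, hi''⟩ := Finset.mem_erase.mp hi'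
    obtain ⟨hia, -⟩ := Finset.mem_erase.mp hi''
    rw [hw0 i hia hib hic, smul_zero]

/-- `X a^i X b^j X c^l` with `i + j + l` even lies in `E`. [folklore] -/
theorem pow_mul_pow_mul_pow_mem_adjoin_evenGens (i j l : ℕ) (h : Even (i + j + l)) :
    (X a ^ i * X b ^ j * X c ^ l : MvPolynomial (Fin n) k) ∈ Algebra.adjoin k (evenGens k n a b c) := by
  set E := Algebra.adjoin k (evenGens k n a b c) with hE
  have haa : (X a ^ 2 : MvPolynomial (Fin n) k) ∈ E := Algebra.subset_adjoin (Or.inl (by simp))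
  have hab' : (X a * X b : MvPolynomial (Fin n) k) ∈ E := Algebra.subset_adjoin (Or.inl (by simp))
  have hac' : (X a * X c : MvPolynomial (Fin n) k) ∈ E := Algebra.subset_adjoin (Or.inl (by simp))
  have hbb : (X b ^ 2 : MvPolynomial (Fin n) k) ∈ E := Algebra.subset_adjoin (Or.inl (by simp))
  have hbc' : (X b * X c : MvPolynomial (Fin n) k) ∈ E := Algebra.subset_adjoin (Or.inl (by simp))
  have hcc : (X c ^ 2 : MvPolynomial (Fin n) k) ∈ E := Algebra.subset_adjoin (Or.inl (by simp))
  rcases Nat.even_or_odd i with ⟨i', hi⟩ | ⟨i', hi⟩ <;>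
    rcases Nat.even_or_odd j with ⟨j', hj⟩ | ⟨j', hj⟩ <;>
      rcases Nat.even_or_odd l with ⟨l', hl⟩ | ⟨l', hl⟩
  · -- (even, even, even)
    have e : (X a ^ i * X b ^ j * X c ^ l : MvPolynomial (Fin n) k) =
        (X a ^ 2) ^ i' * (X b ^ 2) ^ j' * (X c ^ 2) ^ l' := by rw [hi, hj, hl]; ring
    rw [e]
    exact E.mul_mem (E.mul_mem (E.pow_mem haa _) (E.pow_mem hbb _)) (E.pow_mem hcc _)
  · exfalso; rw [hi, hj, hl] at h
    exact Nat.not_even_iff_odd.mpr ⟨i' + j' + l', by ring⟩ h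
  · exfalso; rw [hi, hj, hl] at h
    exact Nat.not_even_iff_odd.mpr ⟨i' + j' + l', by ring⟩ h
  · -- (even, odd, odd)
    have e : (X a ^ i * X b ^ j * X c ^ l : MvPolynomial (Fin n) k) =
        (X a ^ 2) ^ i' * (X b ^ 2) ^ j' * (X c ^ 2) ^ l' * (X b * X c) := by rw [hi, hj, hl]; ring
    rw [e]
    exact E.mul_mem (E.mul_mem (E.mul_mem (E.pow_mem haa _) (E.pow_mem hbb _)) (E.pow_mem hcc _)) hbc'
  · exfalso; rw [hi, hj, hl] at h
    exact Nat.not_even_iff_odd.mpr ⟨i' + j' + l', by ring⟩ h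
  · -- (odd, even, odd)
    have e : (X a ^ i * X b ^ j * X c ^ l : MvPolynomial (Fin n) k) =
        (X a ^ 2) ^ i' * (X b ^ 2) ^ j' * (X c ^ 2) ^ l' * (X a * X c) := by rw [hi, hj, hl]; ring
    rw [e]
    exact E.mul_mem (E.mul_mem (E.mul_mem (E.pow_mem haa _) (E.pow_mem hbb _)) (E.pow_mem hcc _)) hac'
  · -- (odd, odd, even)
    have e : (X a ^ i * X b ^ j * X c ^ l : MvPolynomial (Fin n) k) =
        (X a ^ 2) ^ i' * (X b ^ 2) ^ j' * (X c ^ 2) ^ l' * (X a * X b) := by rw [hi, hj, hl]; ring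
    rw [e]
    exact E.mul_mem (E.mul_mem (E.mul_mem (E.pow_mem haa _) (E.pow_mem hbb _)) (E.pow_mem hcc _)) hab'
  · exfalso; rw [hi, hj, hl] at h
    exact Nat.not_even_iff_odd.mpr ⟨i' + j' + l' + 1, by ring⟩ h

include hab hac hbc hwa hwb hwc hw0 in
/-- **Every even monomial lies in `E`.** [folklore] -/
theorem monomial_mem_adjoin_evenGens (d : Fin n →₀ ℕ) (hd : Finsupp.weight w d = 0) :
    (monomial d (1 : k)) ∈ Algebra.adjoin k (evenGens k n a b c) := by
  classical
  set E := Algebra.adjoin k (evenGens k n a b c) with hE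
  have heven : Even (d a + d b + d c) := by
    rw [weight_eq_three n a b c hab hac hbc w hwa hwb hwc hw0] at hd
    exact (ZMod.natCast_eq_zero_iff_even).mp hd
  rw [monomial_eq, C_1, one_mul, Finsupp.prod_fintype _ _ (fun i => pow_zero _)]
  have hb' : b ∈ Finset.univ.erase a := Finset.mem_erase.mpr ⟨fun h => hab h.symm, Finset.mem_univ b⟩
  have hc' : c ∈ (Finset.univ.erase a).erase b :=
    Finset.mem_erase.mpr ⟨fun h => hbc h.symm, Finset.mem_erase.mpr ⟨fun h => hac h.symm,
      Finset.mem_univ c⟩⟩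
  rw [← Finset.mul_prod_erase _ _ (Finset.mem_univ a), ← Finset.mul_prod_erase _ _ hb',
    ← Finset.mul_prod_erase _ _ hc', ← mul_assoc, ← mul_assoc]
  refine E.mul_mem (pow_mul_pow_mul_pow_mem_adjoin_evenGens k n a b c _ _ _ heven)
    (Subalgebra.prod_mem _ fun i hi => ?_)
  obtain ⟨hic, hi'⟩ := Finset.mem_erase.mp hi
  obtain ⟨hib, hi''⟩ := Finset.mem_erase.mp hi'
  obtain ⟨hia, -⟩ := Finset.mem_erase.mp hi''
  exact E.pow_mem (Algebra.subset_adjoin (Or.inr ⟨i, ⟨hia, hib, hic⟩, rfl⟩)) _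

include hab hac hbc hwa hwb hwc hw0 in
/-- **`E` is the degree-`0` part of the parity grading**: `f ∈ adjoin k (evenGens) ↔ f` is
`w`-homogeneous of degree `0`. [folklore] -/
theorem mem_adjoin_evenGens_iff (f : MvPolynomial (Fin n) k) :
    f ∈ Algebra.adjoin k (evenGens k n a b c) ↔ IsWeightedHomogeneous w f 0 :=
  ToricExit.mem_adjoin_iff_isWeightedHomogeneous_zero w (evenGens k n a b c)
    (isWeightedHomogeneous_zero_of_mem_evenGens k n a b c w hwa hwb hwc hw0)
    (monomial_mem_adjoin_evenGens k n a b c hab hac hbc w hwa hwb hwc hw0) f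

include hab hac hbc in
/-- **Fixed points of the deck involution lie in `E`** (`char k ≠ 2`): if a `k`-algebra endomorphism
`ι` with `ι (X a) = −X a`, `ι (X b) = −X b`, `ι (X c) = −X c`, `ι (X i) = X i` otherwise fixes `f`,
then `f ∈ adjoin k (evenGens)`. [folklore] -/
theorem mem_adjoin_evenGens_of_deck_eq (h2 : (2 : k) ≠ 0)
    (ι : MvPolynomial (Fin n) k →ₐ[k] MvPolynomial (Fin n) k)
    (hιa : ι (X a) = -X a) (hιb : ι (X b) = -X b) (hιc : ι (X c) = -X c)
    (hι : ∀ i, i ≠ a → i ≠ b → i ≠ c → ι (X i) = X i)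
    (f : MvPolynomial (Fin n) k) (hf : ι f = f) :
    f ∈ Algebra.adjoin k (evenGens k n a b c) := by
  classical
  let w : Fin n → ZMod 2 := fun i => if i = a ∨ i = b ∨ i = c then 1 else 0
  have hwa : w a = 1 := if_pos (Or.inl rfl)
  have hwb : w b = 1 := if_pos (Or.inr (Or.inl rfl))
  have hwc : w c = 1 := if_pos (Or.inr (Or.inr rfl))
  have hw0 : ∀ i, i ≠ a → i ≠ b → i ≠ c → w i = 0 :=
    fun i hia hib hic => if_neg (not_or.mpr ⟨hia, not_or.mpr ⟨hib, hic⟩⟩)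
  -- `ι` is the sign involution of `w`
  have hι' : ι = aeval (fun i => if w i = 0 then (X i : MvPolynomial (Fin n) k) else -X i) := by
    refine MvPolynomial.algHom_ext fun i => ?_
    rw [aeval_X]
    by_cases hia : i = a
    · subst hia; rw [hιa, if_neg (by rw [hwa]; decide)]
    by_cases hib : i = b
    · subst hib; rw [hιb, if_neg (by rw [hwb]; decide)]
    by_cases hic : i = c
    · subst hic; rw [hιc, if_neg (by rw [hwc]; decide)]
    rw [hι i hia hib hic, if_pos (hw0 i hia hib hic)]
  have h2' : (2 : k) ∈ nonZeroDivisors k := mem_nonZeroDivisors_of_ne_zero h2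
  rw [hι'] at hf
  exact (mem_adjoin_evenGens_iff k n a b c hab hac hbc w hwa hwb hwc hw0 f).mpr
    (isWeightedHomogeneous_zero_of_signAeval_eq w h2' f hf)

end EvenSubalgebra

section TwistedChartEven

/-! ### The twisted chart lands in the even subalgebra; the `q`-vector and `Q` are even -/

variable (k : Type) [Field k] (n : ℕ) (a b c d : Fin n)
  (hab : a ≠ b) (hac : a ≠ c) (had : a ≠ d) (hbc : b ≠ c) (hbd : b ≠ d) (hcd : c ≠ d)

include hab hac had hbc hbd hcd in
/-- **`ψ_T(k[x]) ⊆ E`**: every element in the image of the twisted chart is even (T-ii +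
`mem_adjoin_evenGens_of_deck_eq`; `char k ≠ 2`). [OURS · L1 W4.5c] -/
theorem twistedChart_mem_adjoin_evenGens (h2 : (2 : k) ≠ 0) (f : MvPolynomial (Fin n) k) :
    twistedChart k n a b c d f ∈ Algebra.adjoin k (evenGens k n a b c) := by
  classical
  let ι : MvPolynomial (Fin n) k →ₐ[k] MvPolynomial (Fin n) k :=
    aeval fun i => if i = a ∨ i = b ∨ i = c then -X i else X i
  have hιa : ι (X a) = -X a := by simp [ι]
  have hιb : ι (X b) = -X b := by simp [ι]
  have hιc : ι (X c) = -X c := by simp [ι]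
  have hι : ∀ i, i ≠ a → i ≠ b → i ≠ c → ι (X i) = X i := by
    intro i hia hib hic; simp [ι, hia, hib, hic]
  exact mem_adjoin_evenGens_of_deck_eq k n a b c hab hac hbc h2 ι hιa hιb hιc hι _
    (deck_twistedChart k n a b c d hab hac had hbc hbd hcd ι hιa hιb hιc hι f)

include hab hac had hbc hbd hcd in
/-- **The `q`-vector is even**: `twistedCofactor j ∈ E` (`char k ≠ 2`). [OURS · L1 W4.5c] -/
theorem twistedCofactor_mem_adjoin_evenGens (h2 : (2 : k) ≠ 0) (j : Fin 8) :
    twistedCofactor k n a b c d j ∈ Algebra.adjoin k (evenGens k n a b c) := by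
  classical
  let ι : MvPolynomial (Fin n) k →ₐ[k] MvPolynomial (Fin n) k :=
    aeval fun i => if i = a ∨ i = b ∨ i = c then -X i else X i
  have hιa : ι (X a) = -X a := by simp [ι]
  have hιb : ι (X b) = -X b := by simp [ι]
  have hιc : ι (X c) = -X c := by simp [ι]
  have hι : ∀ i, i ≠ a → i ≠ b → i ≠ c → ι (X i) = X i := by
    intro i hia hib hic; simp [ι, hia, hib, hic]
  have hιd : ι (X d) = X d := hι d (Ne.symm had) (Ne.symm hbd) (Ne.symm hcd)
  have hιP : ι (twistedP k n a b c d) = -twistedP k n a b c d := by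
    simp only [twistedP, map_add, map_sub, map_mul, map_pow, MvPolynomial.algHom_C,
      MvPolynomial.algebraMap_eq, hιa, hιb, hιc, hιd]
    ring
  have h1 : ι (1 + X a * X c) = 1 + X a * X c := by rw [map_add, map_one, map_mul, hιa, hιc]; ring
  refine mem_adjoin_evenGens_of_deck_eq k n a b c hab hac hbc h2 ι hιa hιb hιc hι _ ?_
  fin_cases j
  · change ι (X a ^ 2) = X a ^ 2
    rw [map_pow, hιa]; ring
  · change ι (X b * X a * (1 + X a * X c) ^ 2) = X b * X a * (1 + X a * X c) ^ 2
    rw [map_mul, map_mul, map_pow, hιa, hιb, h1]; ring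
  · change ι (X a * (1 + X a * X c) * twistedP k n a b c d) = X a * (1 + X a * X c) * twistedP k n a b c d
    rw [map_mul, map_mul, hιa, h1, hιP]; ring
  · change ι (X a * twistedP k n a b c d ^ 3) = X a * twistedP k n a b c d ^ 3
    rw [map_mul, map_pow, hιa, hιP]; ring
  · change ι ((1 + X a * X c) ^ 3) = (1 + X a * X c) ^ 3
    rw [map_pow, h1]
  · change ι ((1 + X a * X c) ^ 2 * twistedP k n a b c d ^ 2) =
      (1 + X a * X c) ^ 2 * twistedP k n a b c d ^ 2
    rw [map_mul, map_pow, map_pow, h1, hιP]; ring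
  · change ι ((1 + X a * X c) * twistedP k n a b c d ^ 4) = (1 + X a * X c) * twistedP k n a b c d ^ 4
    rw [map_mul, map_pow, h1, hιP]; ring
  · change ι (twistedP k n a b c d ^ 6) = twistedP k n a b c d ^ 6
    rw [map_pow, hιP]; ring

include hab hac had hbc hbd hcd in
/-- **`Q` is even**: `twistedQ ∈ E` (`char k ≠ 2`). [OURS · L1 W4.5c] -/
theorem twistedQ_mem_adjoin_evenGens (h2 : (2 : k) ≠ 0) :
    twistedQ k n a b d ∈ Algebra.adjoin k (evenGens k n a b c) := by
  classical
  let ι : MvPolynomial (Fin n) k →ₐ[k] MvPolynomial (Fin n) k :=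
    aeval fun i => if i = a ∨ i = b ∨ i = c then -X i else X i
  have hιa : ι (X a) = -X a := by simp [ι]
  have hιb : ι (X b) = -X b := by simp [ι]
  have hιc : ι (X c) = -X c := by simp [ι]
  have hι : ∀ i, i ≠ a → i ≠ b → i ≠ c → ι (X i) = X i := by
    intro i hia hib hic; simp [ι, hia, hib, hic]
  exact mem_adjoin_evenGens_of_deck_eq k n a b c hab hac hbc h2 ι hιa hιb hιc hι _
    (deck_twistedQ k n a b c d had hbd hcd ι hιa hιb hι)

end TwistedChartEven

end Summit.ResolutionOfSingularities.ResolutionOfSingularities.Theorems.WildQuotientResolution.JordanFour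

end
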